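import Summits.CriticalPhenomena.PercolationContinuityZ3.Theorems.PercNearOneGluingNoHeavyQuantFlowUncross
import HarnessLib

/-!
# QUANT lane R8, T-DEC: the NP-branch GIANT STEP, part 3 — the ZERO-EVICTION EXCHANGE: a full flow at a layer yields the giant-step
# dichotomy (every nonzero low placed in mids, OR the giants absorb the rest), so the node `SGCGiantStep` is `SingleGateConvClosed` in normal form

builds on p205010 (kernel theorem, internal audit signed; external expert review pending)

Support file (`--supports stmt-CriticalPhenomena-4575`), QUANT lane TYPER seat prim-quant-stmt (gen 33), rung R8 of
`run/shared/lean/prim/quant/LADDER.md`.  One theorem, standard axioms, no sorries; imports only `…QuantFlowUncross` (`usage_anti_low`,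
`usage_giant_eq`, `usage_pos_of_compat` over `LawDec.FlowAtT` / `LawDec.usage` of `…QuantLawDecFlows`).  Independent of parts 1–2
(`…QuantSGCGiantStep`, `…QuantSGCGiantStepReduction`), which combine it with arm-2 g37's `flowAtT_of_partial_dichotomy` into
`SGCGiantStep ⟺ SingleGateConvClosed`.

THE STATEMENT (`LawDec.partialMidFlow_dichotomy_of_flowAtT`).  Floor `0 < y < 1`, target `S′ > 0`, layer `j < M`, `L ≥ 0` with a flow at
layer `j` (`FlowAtT y S′ j M L`: every low atom shipped to compatible absorbers at the rates `usage`, no absorber overloaded).  Then there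
is a PARTIAL MID-FLOW `φ` (nonzero lows `1 ≤ t ≤ j`, `2t < S′` into mids `1 ≤ k ≤ j`, `S′ < t + k`; columns loaded by at most their mass;
rows shipping at most their mass — the legality clauses of `flowAtT_of_partial_dichotomy`, = `LawDec.PartialMidFlow` of part 1) such that
EITHER every nonzero low is placed completely, OR `y/(1−y)·(L 0 + Σ_{nonzero lows t}(L t − Σ_k φ t k)) ≤ Σ_{j<h≤M} L h`.
PROOF (one-shot exchange, no iteration).  Let `Z` = the zero's mass shipped to mids by the flow `f`, `g t` = the giant-bound mass of the
nonzero low `t`, `N = Σ_t g t`, `D = max Z N`, and `φ t k := f t k + g t·f 0 k/D` on (nonzero low) × (mid `≤ j`).  The zero's mids have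
`k > S′`, hence are compatible with every nonzero low `t`, and at no higher rate (`usage(t,k) ≤ usage(0,k)` ⟺ `2k ≥ S′`, `usage_anti_low`);
so column `k` carries at most (nonzero load of `f`) + `usage(0,k)·f 0 k·N/D ≤` `f`'s full load `≤ L k`, and row `t` carries
`mid_t + g t·Z/D ≤ L t`.  If `N ≤ Z` (then `D = Z`) every row is full: all nonzero lows placed.  If `Z < N` (`D = N`) the unplaced mass is
`Σ_t g t(1 − Z/N) = N − Z`, so the left side is `y/(1−y)·(Z + g 0 + N − Z) = y/(1−y)·(g 0 + N) ≤ y/(1−y)·Σ_l g l`, which is `f`'s total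
giant load `≤ Σ_{j<h≤M} L h`.  (Census-side reading: "a nonzero low is uniformly better than the zero", arm-2 g37 L2-TRANSPORT §8.)

[this work]; flows and rates: prim-quant-stmt g22, prim-quant-census-2 g54, prim-quant-arm-2 g37 (this lane).  Transportation with gains is
classical; nothing here is cited as a published result.  The gluing rows served [cite: KozmaNitzan2024, Conjecture 3 (p. 15)]; product
measure [cite: Grimmett1999, §1.3 p. 10].
-/

noncomputable section

namespace Summit.CriticalPhenomena.PercolationContinuityZ3.Theorems

namespace Quant

open Finset

namespace LawDec

/-- **THE ZERO-EVICTION EXCHANGE (a full flow yields the giant-step dichotomy).**  Floor `0 < y < 1`, target `S′ > 0`, layer `j < M`,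
`L ≥ 0`.  If `L` has a flow at layer `j` (`LawDec.FlowAtT y S′ j M L`), then there is a partial mid-flow `φ` of `L` (the legality clauses of
`LawDec.flowAtT_of_partial_dichotomy` / `LawDec.PartialMidFlow`: nonzero lows `1 ≤ t ≤ j`, `2t < S′` into mids `1 ≤ k ≤ j` at the rates
`LawDec.usage`, columns loaded by at most their mass, rows shipping at most their mass) which EITHER places every nonzero low completely OR
leaves the giants enough room for everything else: `y/(1−y)·(L 0 + Σ_{nonzero lows}(L t − Σ_k φ t k)) ≤ Σ_{j<h≤M} L h`.
Construction: with `Z` the gate zero's mass shipped to mids, `g t` the giant-bound mass of the nonzero low `t`, `N = Σ g`, set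
`φ t k = f t k + g t·f 0 k / max Z N` on (nonzero low) × (mid) — the zero's mids `k > S′` are compatible with every nonzero low at no higher
rate (`usage_anti_low`), so the columns still fit; if `N ≤ Z` every nonzero low is placed, otherwise exactly `Z` of the nonzero giant-bound
mass moved into the mids and the flow's own giant loads give the inequality.  This is the converse of the dichotomy: with
`flowAtT_of_partial_dichotomy` it shows that DEC(j) ⟺ (AP-able ∨ G-able), whence `SGCGiantStep ⟺ SingleGateConvClosed` (part 2). [this work] -/
theorem partialMidFlow_dichotomy_of_flowAtT (y S' : ℝ) (j M : ℕ) (L : ℕ → ℝ) (hy0 : 0 < y) (hy1 : y < 1) (hS' : 0 < S')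
    (hL0 : ∀ t, 0 ≤ L t) (hjM : j < M) (hF : FlowAtT y S' j M L) :
    ∃ φ : ℕ → ℕ → ℝ,
      (∀ t k, 0 ≤ φ t k) ∧
      (∀ t k, 0 < φ t k → t ≤ j ∧ 2 * (t : ℝ) < S' ∧ k ≤ M ∧ (j + 1 ≤ k ∨ S' < (t : ℝ) + k)) ∧
      (∀ t k, ¬ ((1 ≤ t ∧ t ≤ j ∧ 2 * (t : ℝ) < S') ∧ 1 ≤ k ∧ k ≤ j) → φ t k = 0) ∧
      (∀ k, 1 ≤ k → k ≤ j → ∑ t ∈ Finset.range (j + 1), usage y S' j t k * φ t k ≤ L k) ∧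
      (∀ t, (1 ≤ t ∧ t ≤ j ∧ 2 * (t : ℝ) < S') → ∑ k ∈ Finset.range (M + 1), φ t k ≤ L t) ∧
      ((∀ t, (1 ≤ t ∧ t ≤ j ∧ 2 * (t : ℝ) < S') → ∑ k ∈ Finset.range (M + 1), φ t k = L t) ∨
        y / (1 - y) * (L 0 + ∑ t ∈ Finset.range (j + 1),
            (if (1 ≤ t ∧ t ≤ j ∧ 2 * (t : ℝ) < S') then L t - ∑ k ∈ Finset.range (M + 1), φ t k else 0))
          ≤ ∑ h ∈ Finset.Ico (j + 1) (M + 1), L h) := by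
  classical
  obtain ⟨f, hf0, hsupp, hrow, hcap⟩ := hF
  have h1y : 0 < 1 - y := by linarith
  have hu0 : 0 < y / (1 - y) := div_pos hy0 h1y
  /- ### support facts of `f` -/
  have hf_zero : ∀ l h, ¬ (l ≤ j ∧ 2 * (l : ℝ) < S' ∧ h ≤ M ∧ (j + 1 ≤ h ∨ S' < (l : ℝ) + h)) → f l h = 0 := by
    intro l h hn
    rcases (hf0 l h).eq_or_lt with hz | hp
    · exact hz.symm
    · exact absurd (hsupp l h hp) hn
  have hf_col0 : ∀ l, f l 0 = 0 := by
    intro l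
    refine hf_zero l 0 ?_
    rintro ⟨_, hlow, _, hc⟩
    rcases hc with hc | hc
    · omega
    · have : (0 : ℝ) ≤ l := Nat.cast_nonneg l
      simp only [Nat.cast_zero, add_zero] at hc
      linarith
  have hf_lowcol : ∀ l k, k ≤ j → 2 * (k : ℝ) < S' → f l k = 0 := by
    intro l k hkj hk
    refine hf_zero l k ?_
    rintro ⟨_, hlow, _, hc⟩
    rcases hc with hc | hc
    · omega
    · linarith
  have hf_nonlow : ∀ l h, ¬ (l ≤ j ∧ 2 * (l : ℝ) < S') → f l h = 0 := by
    intro l h hn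
    refine hf_zero l h ?_
    rintro ⟨h1, h2, -, -⟩
    exact hn ⟨h1, h2⟩
  /- ### the predicate and the quantities -/
  set P : ℕ → Prop := fun t => 1 ≤ t ∧ t ≤ j ∧ 2 * (t : ℝ) < S' with hP
  set Z : ℝ := ∑ k ∈ Finset.range (j + 1), f 0 k with hZ
  set g : ℕ → ℝ := fun t => ∑ h ∈ Finset.Ico (j + 1) (M + 1), f t h with hg
  set N : ℝ := ∑ t ∈ Finset.range (j + 1), (if P t then g t else 0) with hN
  set D : ℝ := max Z N with hD
  have hZ0 : 0 ≤ Z := Finset.sum_nonneg fun k _ => hf0 0 k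
  have hg0 : ∀ t, 0 ≤ g t := fun t => Finset.sum_nonneg fun h _ => hf0 t h
  have hN0 : 0 ≤ N := Finset.sum_nonneg fun t _ => by
    split_ifs
    · exact hg0 t
    · exact le_rfl
  have hD0 : 0 ≤ D := le_max_of_le_left hZ0
  have hZD : Z ≤ D := le_max_left _ _
  have hND : N ≤ D := le_max_right _ _
  have hfZ : ∀ k, k ≤ j → f 0 k ≤ Z := fun k hk =>
    Finset.single_le_sum (f := fun k => f 0 k) (fun k _ => hf0 0 k) (Finset.mem_range.2 (Nat.lt_succ_of_le hk))
  have hmulZD : ∀ a : ℝ, 0 ≤ a → a * Z / D ≤ a := by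
    intro a ha
    rcases hD0.eq_or_lt with h0 | hpos
    · rw [← h0, div_zero]; exact ha
    · rw [div_le_iff₀ hpos]; nlinarith
  -- row split of `f`
  have hsplit : ∀ t, ∑ h ∈ Finset.range (M + 1), f t h = ∑ k ∈ Finset.range (j + 1), f t k + g t := by
    intro t
    rw [Finset.range_eq_Ico, ← Finset.sum_Ico_consecutive _ (Nat.zero_le (j + 1)) (by omega : j + 1 ≤ M + 1),
      ← Finset.range_eq_Ico]
  have hLt : ∀ t, P t → L t = ∑ k ∈ Finset.range (j + 1), f t k + g t := by
    intro t ht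
    rw [← hsplit t, hrow t ht.2.1 ht.2.2]
  have hL0eq : L 0 = Z + g 0 := by
    rw [← hsplit 0, hrow 0 (Nat.zero_le j) (by simpa using hS')]
  /- ### the partial flow -/
  set φ : ℕ → ℕ → ℝ := fun t k => if P t ∧ 1 ≤ k ∧ k ≤ j then f t k + g t * f 0 k / D else 0 with hφ
  have hφ_nonneg : ∀ t k, 0 ≤ φ t k := by
    intro t k
    simp only [hφ]
    split_ifs
    · exact add_nonneg (hf0 t k) (div_nonneg (mul_nonneg (hg0 t) (hf0 0 k)) hD0)
    · exact le_rfl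
  -- row sums of `φ`
  have hrowφ : ∀ t, P t → ∑ k ∈ Finset.range (M + 1), φ t k = ∑ k ∈ Finset.range (j + 1), f t k + g t * Z / D := by
    intro t ht
    have e1 : ∑ k ∈ Finset.range (M + 1), φ t k = ∑ k ∈ Finset.range (j + 1), φ t k := by
      rw [Finset.range_eq_Ico, ← Finset.sum_Ico_consecutive _ (Nat.zero_le (j + 1)) (by omega : j + 1 ≤ M + 1),
        ← Finset.range_eq_Ico, add_eq_left]
      refine Finset.sum_eq_zero fun k hk => ?_
      rw [Finset.mem_Ico] at hk
      simp only [hφ]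
      rw [if_neg]
      rintro ⟨-, -, hkj⟩
      omega
    have e2 : ∀ k ∈ Finset.range (j + 1), φ t k = f t k + g t * (f 0 k / D) := by
      intro k hk
      rw [Finset.mem_range] at hk
      simp only [hφ]
      by_cases hk1 : 1 ≤ k
      · rw [if_pos ⟨ht, hk1, by omega⟩]; ring
      · have hk0 : k = 0 := by omega
        subst hk0
        rw [if_neg (by rintro ⟨-, h, -⟩; omega), hf_col0 t, hf_col0 0]; ring
    rw [e1, Finset.sum_congr rfl e2, Finset.sum_add_distrib, ← Finset.mul_sum, ← Finset.sum_div]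
    ring
  refine ⟨φ, hφ_nonneg, ?_, ?_, ?_, ?_, ?_⟩
  /- ### support -/
  · intro t k hpos
    have hc : P t ∧ 1 ≤ k ∧ k ≤ j := by
      by_contra hn
      simp only [hφ, if_neg hn] at hpos
      exact lt_irrefl _ hpos
    obtain ⟨ht, hk1, hkj⟩ := hc
    refine ⟨ht.2.1, ht.2.2, by omega, Or.inr ?_⟩
    simp only [hφ, if_pos (show P t ∧ 1 ≤ k ∧ k ≤ j from ⟨ht, hk1, hkj⟩)] at hpos
    rcases (hf0 t k).eq_or_lt with hz | hp
    · -- the added part is positive, so the zero used the mid `k`: `S' < k`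
      rw [← hz, zero_add] at hpos
      have hf0k : 0 < f 0 k := by
        rcases (hf0 0 k).eq_or_lt with hz' | hp'
        · rw [← hz', mul_zero, zero_div] at hpos; exact absurd hpos (lt_irrefl _)
        · exact hp'
      rcases (hsupp 0 k hf0k).2.2.2 with h | h
      · omega
      · have : (0 : ℝ) ≤ t := Nat.cast_nonneg t
        simp only [Nat.cast_zero, zero_add] at h
        linarith
    · rcases (hsupp t k hp).2.2.2 with h | h
      · omega
      · exact h
  /- ### vanishing off the box -/
  · intro t k hn
    simp only [hφ]
    exact if_neg hn
  /- ### columns -/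
  · intro k hk1 hkj
    by_cases hklow : 2 * (k : ℝ) < S'
    · have hz : ∀ t ∈ Finset.range (j + 1), usage y S' j t k * φ t k = 0 := by
        intro t _
        simp only [hφ]
        split_ifs
        · rw [hf_lowcol t k hkj hklow, hf_lowcol 0 k hkj hklow]; ring
        · ring
      rw [Finset.sum_congr rfl hz, Finset.sum_const_zero]
      exact hL0 k
    · have hkabs : S' ≤ 2 * (k : ℝ) := not_lt.1 hklow
      have hcapk := hcap k (by omega) (Or.inr hkabs)
      -- `f`'s column load: the zero's term and the nonzero lows' terms
      have hrest : ∑ t ∈ Finset.range (j + 1), (if P t then usage y S' j t k * f t k else 0)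
          = ∑ t ∈ Finset.range (j + 1), usage y S' j t k * f t k - usage y S' j 0 k * f 0 k := by
        have e : ∑ t ∈ Finset.range (j + 1), usage y S' j t k * f t k
            = ∑ t ∈ Finset.range (j + 1), (if P t then usage y S' j t k * f t k else 0)
              + ∑ t ∈ Finset.range (j + 1), (if P t then 0 else usage y S' j t k * f t k) := by
          rw [← Finset.sum_add_distrib]
          refine Finset.sum_congr rfl fun t _ => ?_
          split_ifs <;> ring
        have hz : ∑ t ∈ Finset.range (j + 1), (if P t then 0 else usage y S' j t k * f t k)
            = usage y S' j 0 k * f 0 k := by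
          rw [Finset.sum_eq_single 0]
          · rw [if_neg]
            rintro ⟨h, -, -⟩
            omega
          · intro t ht ht0
            rw [Finset.mem_range] at ht
            split_ifs with hPt
            · rfl
            · have hn : ¬ (t ≤ j ∧ 2 * (t : ℝ) < S') := fun hh => hPt ⟨by omega, hh.1, hh.2⟩
              rw [hf_nonlow t k hn, mul_zero]
          · intro h
            exact absurd (Finset.mem_range.2 (Nat.succ_pos j)) h
        rw [e, hz]
        ring
      have hexp : ∑ t ∈ Finset.range (j + 1), usage y S' j t k * φ t k
          = ∑ t ∈ Finset.range (j + 1), (if P t then usage y S' j t k * f t k else 0)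
            + f 0 k / D * ∑ t ∈ Finset.range (j + 1), (if P t then usage y S' j t k * g t else 0) := by
        rw [Finset.mul_sum, ← Finset.sum_add_distrib]
        refine Finset.sum_congr rfl fun t _ => ?_
        simp only [hφ]
        by_cases hPt : P t
        · rw [if_pos ⟨hPt, hk1, hkj⟩, if_pos hPt, if_pos hPt]; ring
        · rw [if_neg (fun h => hPt h.1), if_neg hPt, if_neg hPt]; ring
      rcases (hf0 0 k).eq_or_lt with hz0 | hpos
      · rw [hexp, ← hz0, zero_div, zero_mul, add_zero, hrest, ← hz0, mul_zero, sub_zero]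
        exact hcapk
      · -- the zero used the mid `k`, so `S' < k`, and every nonzero low is cheaper there
        have hS'k : S' < (k : ℝ) := by
          rcases (hsupp 0 k hpos).2.2.2 with h | h
          · omega
          · simpa using h
        have hu00 : 0 ≤ usage y S' j 0 k :=
          (usage_pos_of_compat y S' j 0 k hy0 hy1 (by simpa using hS') (by omega) (Or.inr (by simpa using hS'k))).le
        have hmono : ∑ t ∈ Finset.range (j + 1), (if P t then usage y S' j t k * g t else 0) ≤ usage y S' j 0 k * N := by
          rw [hN, Finset.mul_sum]
          refine Finset.sum_le_sum fun t _ => ?_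
          split_ifs with hPt
          · refine mul_le_mul_of_nonneg_right ?_ (hg0 t)
            exact usage_anti_low y S' j 0 t k hy0 hy1 (by exact hPt.1) hPt.2.2 (by simpa using hS'k) (Or.inr hkabs)
          · rw [mul_zero]
        have hDpos : 0 < D := lt_of_lt_of_le (lt_of_lt_of_le hpos (hfZ k hkj)) hZD
        have hcoef : f 0 k / D * (usage y S' j 0 k * N) ≤ usage y S' j 0 k * f 0 k := by
          rw [div_mul_eq_mul_div, div_le_iff₀ hDpos]
          have := mul_le_mul_of_nonneg_left hND (mul_nonneg hu00 hpos.le)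
          nlinarith
        calc ∑ t ∈ Finset.range (j + 1), usage y S' j t k * φ t k
            = ∑ t ∈ Finset.range (j + 1), (if P t then usage y S' j t k * f t k else 0)
              + f 0 k / D * ∑ t ∈ Finset.range (j + 1), (if P t then usage y S' j t k * g t else 0) := hexp
          _ ≤ (∑ t ∈ Finset.range (j + 1), usage y S' j t k * f t k - usage y S' j 0 k * f 0 k)
              + f 0 k / D * (usage y S' j 0 k * N) := by
                rw [hrest]
                linarith [mul_le_mul_of_nonneg_left hmono (div_nonneg hpos.le hD0)]
          _ ≤ ∑ t ∈ Finset.range (j + 1), usage y S' j t k * f t k := by linarith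
          _ ≤ L k := hcapk
  /- ### rows -/
  · intro t ht
    rw [hrowφ t ht, hLt t ht]
    linarith [hmulZD (g t) (hg0 t)]
  /- ### the dichotomy -/
  · by_cases hNZ : N ≤ Z
    · -- every nonzero low is placed
      left
      intro t ht
      rw [hrowφ t ht, hLt t ht]
      rcases hZ0.eq_or_lt with hZz | hZpos
      · -- `Z = 0`: then `N = 0` and every `g t` with `P t` vanishes
        have hN0' : N = 0 := le_antisymm (by rw [hZz]; exact hNZ) hN0
        have hgt : g t = 0 := by
          have hmem : t ∈ Finset.range (j + 1) := Finset.mem_range.2 (Nat.lt_succ_of_le ht.2.1)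
          have hPt : P t := ht
          have := (Finset.sum_eq_zero_iff_of_nonneg (fun s _ => by
            show (0 : ℝ) ≤ if P s then g s else 0
            split_ifs
            · exact hg0 s
            · exact le_rfl)).1 hN0' t hmem
          rwa [if_pos hPt] at this
        rw [hgt, zero_mul, zero_div]
      · have hDZ : D = Z := max_eq_left hNZ
        rw [hDZ, mul_div_assoc, div_self hZpos.ne', mul_one]
    · -- the giants take the rest
      right
      have hZN : Z < N := not_le.1 hNZ
      have hNpos : 0 < N := lt_of_le_of_lt hZ0 hZN
      have hDN : D = N := max_eq_right hZN.le
      -- the unplaced mass is `N − Z`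
      have hun : ∑ t ∈ Finset.range (j + 1),
          (if (1 ≤ t ∧ t ≤ j ∧ 2 * (t : ℝ) < S') then L t - ∑ k ∈ Finset.range (M + 1), φ t k else 0) = N - Z := by
        have e : ∀ t ∈ Finset.range (j + 1),
            (if (1 ≤ t ∧ t ≤ j ∧ 2 * (t : ℝ) < S') then L t - ∑ k ∈ Finset.range (M + 1), φ t k else 0)
              = (1 - Z / N) * (if P t then g t else 0) := by
          intro t _
          by_cases hPt : P t
          · rw [if_pos hPt, if_pos hPt, hrowφ t hPt, hLt t hPt, hDN]
            ring
          · rw [if_neg hPt, if_neg hPt, mul_zero]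
        rw [Finset.sum_congr rfl e, ← Finset.mul_sum, ← hN, sub_mul, one_mul, div_mul_cancel₀ Z hNpos.ne']
      -- the giant loads of `f`
      have hgiants : y / (1 - y) * ∑ l ∈ Finset.range (j + 1), g l ≤ ∑ h ∈ Finset.Ico (j + 1) (M + 1), L h := by
        have hcol : ∀ h ∈ Finset.Ico (j + 1) (M + 1),
            y / (1 - y) * ∑ l ∈ Finset.range (j + 1), f l h ≤ L h := by
          intro h hh
          rw [Finset.mem_Ico] at hh
          have hc := hcap h (by omega) (Or.inl hh.1)
          have e : ∑ l ∈ Finset.range (j + 1), usage y S' j l h * f l h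
              = y / (1 - y) * ∑ l ∈ Finset.range (j + 1), f l h := by
            rw [Finset.mul_sum]
            refine Finset.sum_congr rfl fun l _ => ?_
            rw [usage_giant_eq y S' j l h hh.1]
          rw [e] at hc
          exact hc
        calc y / (1 - y) * ∑ l ∈ Finset.range (j + 1), g l
            = ∑ h ∈ Finset.Ico (j + 1) (M + 1), y / (1 - y) * ∑ l ∈ Finset.range (j + 1), f l h := by
              simp only [hg]
              rw [Finset.sum_comm, Finset.mul_sum]
          _ ≤ ∑ h ∈ Finset.Ico (j + 1) (M + 1), L h := Finset.sum_le_sum hcol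
      -- `g 0 + N ≤ Σ g`
      have hgsum : g 0 + N ≤ ∑ l ∈ Finset.range (j + 1), g l := by
        have e : ∑ l ∈ Finset.range (j + 1), g l = N + ∑ l ∈ Finset.range (j + 1), (if P l then 0 else g l) := by
          rw [hN, ← Finset.sum_add_distrib]
          refine Finset.sum_congr rfl fun l _ => ?_
          split_ifs <;> ring
        have h0 : g 0 ≤ ∑ l ∈ Finset.range (j + 1), (if P l then 0 else g l) := by
          have := Finset.single_le_sum (f := fun l => if P l then (0 : ℝ) else g l)
            (fun l _ => by
              show (0 : ℝ) ≤ if P l then 0 else g l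
              split_ifs
              · exact le_rfl
              · exact hg0 l)
            (Finset.mem_range.2 (Nat.succ_pos j))
          have hP0 : ¬ P 0 := by rintro ⟨h, -, -⟩; omega
          simpa [if_neg hP0] using this
        linarith
      rw [hun, hL0eq]
      calc y / (1 - y) * (Z + g 0 + (N - Z)) = y / (1 - y) * (g 0 + N) := by ring
        _ ≤ y / (1 - y) * ∑ l ∈ Finset.range (j + 1), g l := mul_le_mul_of_nonneg_left hgsum hu0.le
        _ ≤ ∑ h ∈ Finset.Ico (j + 1) (M + 1), L h := hgiants

end LawDec

end Quant

end Summit.CriticalPhenomena.PercolationContinuityZ3.Theorems
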